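import Summits.QuantumFields.BalabanUV.T4Continuum.Support.NE7EffectiveFormCoarseCurlAllLevels
import Summits.QuantumFields.BalabanUV.T4Continuum.Support.SpreadLiftWords
import HarnessLib

/-!
# NE7EffectiveFormFlatZeroModes — THE ZERO MODES OF THE `(j+1)`-STEP EFFECTIVE QUADRATIC FORM AT THE FLAT BACKGROUND: IT VANISHES ON EXACT FIELDS (LINEARISED GAUGE DIRECTIONS)
# AND ON CONSTANT FIELDS, EVERY LEVEL `j`, EVERY VOLUME `N` (`d = 4` headline; the lifts in every `d`)

ROAD-G115 §11 (ii) of the lineage `b2b-balaban-t4-ne7-p1` (CRUX PROVER NE7 #1 = OWNER of BINDER row NE7), generation 116: the converse half of «`ker Δ^{flat}_{j+1}` = closed fields»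
(✓ `NE7EffectiveFormCoarseCurlAllLevels.effectiveForm_kernel_closed_flat_allLevels` gave `⊆ closed`; here `⊇ exact + constants`; closed = exact ⊕ constants on the periodic box is the
discrete de Rham statement, not typed here).  WHAT ([folklore]; 0 def, 0 sorry):
* §1 `effectiveForm_nonneg_flat`, **`effectiveForm_eq_zero_of_curlFree_lift`**: a skew fine field `X` with `levelQ' j 1 X = v` and `curl_1 X̃ ≡ 0` forces `D²(minAct_{j+1} ∘ chart_1)(0)[v,v] = 0`
  (✓ `minAct_hessian_flat_curl`: the Hessian is the least element of `{w^{j+1}·Σ‖curl_1 X̃‖² : levelQ' X = v}`).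
* §2 LIFTS THROUGH THE ITERATED LINEARISED AVERAGE (every `d`): `Tside_const` (`T_c` of a constant 1-form `a` is `L•a_κ`), `fderiv_coord_flatCfg_const` (`T(const a) = const (L•a)`),
  **`levelQ'_flatCfg_const`** (`levelQ' j 1 (const a) = skewPR (const (L^{j+1}•a))`); `fderiv_coord_flatCfg_resDir_gaugeDir` (`T(res (gaugeDir 1 Λ)) = res (gaugeDir 1 (Λ ∘ (L•)))`, ✓
  `NE3TangentFlatPush.cpush_flatCfg_gaugeDir` + ✓ `fderiv_coord_resDir`), **`levelQ'_flatCfg_resDir_gaugeDir`** (`levelQ' j 1 (res (gaugeDir 1 Λ)) = skewPR (res (gaugeDir 1 (Λ ∘ (L^{j+1}•))))`).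
* §3 (`d = 4`) **`effectiveForm_exact_add_const_eq_zero_flat_allLevels`**: for every `N`-periodic `𝔲(n)`-valued site field `λ` and every `c : Fin 4 → 𝔲(n)`, the coarse field
  `ṽ = gaugeDir 1 λ + const c` (`= (λ(x) − λ(x+e_μ)) + c_μ`) has `D²(minAct_{j+1} ∘ chart_1)(0)[v, v] = 0` — lift `X̃ = gaugeDir 1 (λ ∘ ⌊·∕L^{j+1}⌋) + const (L^{−(j+1)}•c)`, curl-free;
  corollaries `effectiveForm_exact_eq_zero_flat_allLevels` (`c = 0`: GAUGE INVARIANCE of the effective form at second order) and `effectiveForm_const_eq_zero_flat_allLevels` (`λ = 0`: the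
  ZERO MODE).
HONEST FRAMING: flat datum; linear-algebraic zero modes of OUR variational `Δ_{j+1}` (B11 (8) minimisers with `sfClass`); nothing of Bałaban's asserted; NOT NE7 as a spine node; spine 0∕9;
NOT infinite volume, NOT mass gap, NOT BetaPertH, NOT Clay.
-/

set_option autoImplicit false

open scoped BigOperators Matrix Matrix.Norms.L2Operator Topology
open NormedSpace Finset

namespace Summit.QuantumFields.BalabanUV.T4Continuum.NE7EffectiveFormFlatZeroModes

open Literature.MathematicalPhysics.QuantumFieldTheory.Balaban1983to89
open B7Prop1Explicit B7Prop2Explicit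
open T4AveragingDeficitWall (curl curlAt IsSkewDir)
open T4AveragingDeficitWallBoundary (IsPeriodicCfg)
open AveragingDeficitPeriodicCounting (IsPeriodicDir)
open AveragingDeficitTorusChart (TDir chart chartDir resDir redN chartDir_id_resDir)
open AveragingDeficitChartCalculus (coord cavg)
open AveragingDeficitTwoLevelPrep (skewSub skewPR skewPF skewPF_of_mem twoLevelQ')
open AveragingDeficitMultiLevelPrep (tower levelQ' tower_ne_zero cpush fderiv_coord_resDir)
open BlockAveragePushDirGauge (gaugeDir isPeriodicDir_gaugeDir)
open BlockAveragePushDirSplit (sum_blockWeight_eq_one)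
open BlockAverageCurrentAbelian (asum_shift)
open NE3TangentFlatPush (cpush_flatCfg_gaugeDir gaugeDir_flatCfg)
open SkeletonLattice (cdiv cdiv_add_period)
open SpreadLiftWords (cdiv_smul_add_boxVec)
open MinimalActionLevels (perWin stepWt stepWt_pos)
open MinimalActionSandwich (minAct)
open MinimalActionRate (sfClass)
open MinimalActionWitness (flatCfg isPeriodicCfg_flatCfg)
open MatrixNorms (nhsNormSq nhsNormSq_nonneg)
open NE7MinActHessianFlatCurl (minAct_hessian_flat_curl)
open NE7FlatAverageCurlCommutation (curlAt_flatCfg fderiv_coord_flatCfg_apply norm_Wcx_flatCfg_sub_one_lt levelQ'_succ_flatCfg)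
open NE7EffectiveFormCoarseCurlAllLevels (tower_window)

noncomputable section

variable {d : ℕ} {n : Type} [Fintype n] [DecidableEq n]

/-! ## §1 Non-negativity of the effective form; vanishing from a curl-free lift (`d = 4`) -/

/-- **The `(j+1)`-step effective form at the flat datum is non-negative, and VANISHES on every `v` admitting a skew, curl-free fine lift `X` with `levelQ' j 1 X = v`.** [folklore] -/
theorem effectiveForm_eq_zero_of_curlFree_lift [Nonempty n] {L : ℕ} [NeZero L] (hL : 2 ≤ L) :
    ∃ ε₀ : ℝ, 0 < ε₀ ∧ ∀ ε : ℝ, 0 < ε → ε ≤ ε₀ → ∀ (N : ℕ) [NeZero N], 1 ≤ N → ∀ (j : ℕ) (v : ↥(skewSub 4 n N)),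
      0 ≤ fderiv ℝ (fderiv ℝ (fun y : ↥(skewSub 4 n N) => minAct 4 (sfClass 4 L N ε) L N (j + 1)
            (chart (ContinuousLinearMap.id ℝ (Matrix n n ℂ)) N (flatCfg : Site 4 → Fin 4 → (Matrix n n ℂ)ˣ) (y : TDir 4 n N)))) 0 v v ∧
      ∀ X : ↥(skewSub 4 n (L * tower L N j)),
        levelQ' L N j (flatCfg : Site 4 → Fin 4 → (Matrix n n ℂ)ˣ) (X : TDir 4 n (L * tower L N j)) = v →
        (∀ p ∈ perWin 4 (N * L ^ (j + 1)),
          curl (flatCfg : Site 4 → Fin 4 → (Matrix n n ℂ)ˣ) (chartDir (ContinuousLinearMap.id ℝ (Matrix n n ℂ)) (L * tower L N j) (X : TDir 4 n (L * tower L N j))) p = 0) →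
        fderiv ℝ (fderiv ℝ (fun y : ↥(skewSub 4 n N) => minAct 4 (sfClass 4 L N ε) L N (j + 1)
            (chart (ContinuousLinearMap.id ℝ (Matrix n n ℂ)) N (flatCfg : Site 4 → Fin 4 → (Matrix n n ℂ)ˣ) (y : TDir 4 n N)))) 0 v v = 0 := by
  have hL1 : 1 ≤ L := by omega
  have hw : 0 ≤ ((stepWt 4 L)⁻¹) ^ 1 := pow_nonneg (inv_nonneg.mpr (stepWt_pos (d := 4) L hL1).le) _
  obtain ⟨ε₀, hε₀, H⟩ := minAct_hessian_flat_curl (n := n) hL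
  refine ⟨ε₀, hε₀, fun ε hε hεle N _ hN j v => ?_⟩
  obtain ⟨-, hleast⟩ := H ε hε hεle N hN j
  have hw' : 0 ≤ ((stepWt 4 L)⁻¹) ^ (j + 1) := pow_nonneg (inv_nonneg.mpr (stepWt_pos (d := 4) L hL1).le) _
  have hnonneg : 0 ≤ fderiv ℝ (fderiv ℝ (fun y : ↥(skewSub 4 n N) => minAct 4 (sfClass 4 L N ε) L N (j + 1)
      (chart (ContinuousLinearMap.id ℝ (Matrix n n ℂ)) N (flatCfg : Site 4 → Fin 4 → (Matrix n n ℂ)ˣ) (y : TDir 4 n N)))) 0 v v := by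
    obtain ⟨X, -, hval⟩ := (hleast v).1
    rw [hval]
    exact mul_nonneg hw' (Finset.sum_nonneg fun p _ => nhsNormSq_nonneg _)
  refine ⟨hnonneg, fun X hXv hcurl => le_antisymm ?_ hnonneg⟩
  have hmem := (hleast v).2 ⟨X, hXv, rfl⟩
  have hzero : ∑ p ∈ perWin 4 (N * L ^ (j + 1)),
      nhsNormSq (curl (flatCfg : Site 4 → Fin 4 → (Matrix n n ℂ)ˣ) (chartDir (ContinuousLinearMap.id ℝ (Matrix n n ℂ)) (L * tower L N j) (X : TDir 4 n (L * tower L N j))) p) = 0 :=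
    Finset.sum_eq_zero fun p hp => by rw [hcurl p hp]; simp [nhsNormSq]
  rw [hzero, mul_zero] at hmem
  exact hmem

/-! ## §2 Lifts through the iterated linearised average at the flat configuration (every `d`) -/

/-- The abelian contour sum of a CONSTANT 1-form `a` does not depend on the base point. [folklore] -/
theorem asum_const_base (a : Fin d → Matrix n n ℂ) (x y : Site d) (w : List (Letter d)) :
    asum (fun (_ : Site d) (μ : Fin d) => a μ) x w = asum (fun (_ : Site d) (μ : Fin d) => a μ) y w := by
  have h := asum_shift (fun (_ : Site d) (μ : Fin d) => a μ) (y - x) x w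
  rw [show x + (y - x) = y by abel] at h
  exact h

/-- **`T_c` of a constant 1-form `a` is `L • a_κ`** (`c` an `L`-bond in direction `κ`: the tree legs cancel, the straight segment contributes `L` copies of `a_κ`). [folklore] -/
theorem Tside_const (L : ℕ) (hL : 1 ≤ L) (a : Fin d → Matrix n n ℂ) (q : Site d) (κ : Fin d) :
    Tside L (fun (_ : Site d) (μ : Fin d) => a μ) q κ = (L : ℝ) • a κ := by
  unfold Tside
  have hterm : ∀ r : Fin d → Fin L,
      asum (fun (_ : Site d) (μ : Fin d) => a μ) q (gammaWord L κ (boxVec L r)) = (L : ℝ) • a κ := by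
    intro r
    rw [asum_gammaWord, asum_const_base a (q + (L : ℤ) • e κ) q, add_sub_cancel_left, asum_seg_natCast, Finset.sum_const, Finset.card_range,
      ← Nat.cast_smul_eq_nsmul ℝ]
  simp only [hterm, ← Finset.sum_smul, sum_blockWeight_eq_one L hL, one_smul]

/-- **`T (const a) = const (L • a)`**: one linearised averaging step multiplies a constant torus field by `L`. [folklore] -/
theorem fderiv_coord_flatCfg_const {L M : ℕ} [NeZero L] [NeZero M] [NeZero (L * M)] (a : Fin d → Matrix n n ℂ) :
    (fderiv ℝ (coord (ContinuousLinearMap.id ℝ (Matrix n n ℂ)) L M (flatCfg : Site d → Fin d → (Matrix n n ℂ)ˣ)) 0)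
        (fun (_ : Fin d → Fin (L * M)) (κ : Fin d) => a κ)
      = fun (_ : Fin d → Fin M) (κ : Fin d) => (L : ℝ) • a κ := by
  have hL : 1 ≤ L := Nat.one_le_iff_ne_zero.mpr (NeZero.ne L)
  funext r κ
  rw [fderiv_coord_flatCfg_apply]
  exact Tside_const L hL a _ κ

/-- **`levelQ' j 1 (const a) = skewPR (const (L^{j+1} • a))`**: the `(j+1)`-fold linearised average of a constant field. [folklore] -/
theorem levelQ'_flatCfg_const {L N : ℕ} [NeZero L] [NeZero N] :
    ∀ (j : ℕ) (a : Fin d → Matrix n n ℂ),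
      levelQ' L N j (flatCfg : Site d → Fin d → (Matrix n n ℂ)ˣ) (fun (_ : Fin d → Fin (L * tower L N j)) (κ : Fin d) => a κ)
        = skewPR N (fun (_ : Fin d → Fin N) (κ : Fin d) => ((L : ℝ) ^ (j + 1)) • a κ)
  | 0, a => by
      haveI : NeZero (L * N) := ⟨Nat.mul_ne_zero (NeZero.ne L) (NeZero.ne N)⟩
      show skewPR N ((fderiv ℝ (coord (ContinuousLinearMap.id ℝ (Matrix n n ℂ)) L N (flatCfg : Site d → Fin d → (Matrix n n ℂ)ˣ)) 0)
        (fun (_ : Fin d → Fin (L * N)) (κ : Fin d) => a κ)) = _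
      rw [fderiv_coord_flatCfg_const, zero_add, pow_one]
  | j + 1, a => by
      haveI : NeZero (L * tower L N j) := ⟨Nat.mul_ne_zero (NeZero.ne L) (tower_ne_zero L N j)⟩
      haveI : NeZero (L * (L * tower L N j)) := ⟨Nat.mul_ne_zero (NeZero.ne L) (Nat.mul_ne_zero (NeZero.ne L) (tower_ne_zero L N j))⟩
      rw [levelQ'_succ_flatCfg]
      have h1 := fderiv_coord_flatCfg_const (d := d) (n := n) (L := L) (M := L * tower L N j) a
      have h2 := levelQ'_flatCfg_const (L := L) (N := N) j (fun κ => (L : ℝ) • a κ)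
      simp only [smul_smul, ← pow_succ] at h2
      show levelQ' L N j (flatCfg : Site d → Fin d → (Matrix n n ℂ)ˣ)
          ((fderiv ℝ (coord (ContinuousLinearMap.id ℝ (Matrix n n ℂ)) L (L * tower L N j) (flatCfg : Site d → Fin d → (Matrix n n ℂ)ˣ)) 0)
            (fun (_ : Fin d → Fin (L * (L * tower L N j))) (κ : Fin d) => a κ)) = _
      rw [h1]
      exact h2

/-- **`T (res (gaugeDir 1 Λ)) = res (gaugeDir 1 (Λ ∘ (L•)))`**: one linearised averaging step maps the flat pure gauge with an `(L·M)`-periodic potential `Λ` to the flat pure gauge with potential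
`y ↦ Λ(L•y)` (✓ `cpush_flatCfg_gaugeDir` read through ✓ `fderiv_coord_resDir`). [folklore] -/
theorem fderiv_coord_flatCfg_resDir_gaugeDir {L M : ℕ} [NeZero L] [NeZero M] [NeZero (L * M)] {Λ : Site d → Matrix n n ℂ}
    (hΛ : ∀ (x : Site d) (i : Fin d), Λ (x + ((L * M : ℕ) : ℤ) • e i) = Λ x) :
    (fderiv ℝ (coord (ContinuousLinearMap.id ℝ (Matrix n n ℂ)) L M (flatCfg : Site d → Fin d → (Matrix n n ℂ)ˣ)) 0)
        (resDir (L * M) (gaugeDir (flatCfg : Site d → Fin d → (Matrix n n ℂ)ˣ) Λ))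
      = resDir M (gaugeDir (flatCfg : Site d → Fin d → (Matrix n n ℂ)ˣ) (fun y => Λ ((L : ℤ) • y))) := by
  have hL : 1 ≤ L := Nat.one_le_iff_ne_zero.mpr (NeZero.ne L)
  have hper : IsPeriodicDir (gaugeDir (flatCfg : Site d → Fin d → (Matrix n n ℂ)ˣ) Λ) ((L * M : ℕ) : ℤ) :=
    isPeriodicDir_gaugeDir (isPeriodicCfg_flatCfg _) hΛ
  rw [fderiv_coord_resDir (fun q κ r => norm_Wcx_flatCfg_sub_one_lt L q κ r) hper]
  show resDir M (cpush L (flatCfg : Site d → Fin d → (Matrix n n ℂ)ˣ) (gaugeDir (flatCfg : Site d → Fin d → (Matrix n n ℂ)ˣ) Λ)) = _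
  rw [cpush_flatCfg_gaugeDir L hL]

omit [Fintype n] [DecidableEq n] in
/-- Periodicity is inherited by `Λ ∘ (L•)`: period `L·P` for `Λ` gives period `P`. [folklore] -/
theorem periodic_comp_smul {L : ℕ} {P : ℤ} {Λ : Site d → Matrix n n ℂ} (hΛ : ∀ (x : Site d) (i : Fin d), Λ (x + ((L : ℤ) * P) • e i) = Λ x)
    (y : Site d) (i : Fin d) : Λ ((L : ℤ) • (y + P • e i)) = Λ ((L : ℤ) • y) := by
  rw [smul_add, smul_smul]
  exact hΛ _ i

/-- **`levelQ' j 1 (res (gaugeDir 1 Λ)) = skewPR (res (gaugeDir 1 (Λ ∘ (L^{j+1}•))))`**: the `(j+1)`-fold linearised average of a flat pure gauge with an `(L·tower L N j)`-periodic potential.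
[folklore] -/
theorem levelQ'_flatCfg_resDir_gaugeDir {L N : ℕ} [NeZero L] [NeZero N] :
    ∀ (j : ℕ) (Λ : Site d → Matrix n n ℂ), (∀ (x : Site d) (i : Fin d), Λ (x + ((L * tower L N j : ℕ) : ℤ) • e i) = Λ x) →
      levelQ' L N j (flatCfg : Site d → Fin d → (Matrix n n ℂ)ˣ)
          (resDir (L * tower L N j) (gaugeDir (flatCfg : Site d → Fin d → (Matrix n n ℂ)ˣ) Λ))
        = skewPR N (resDir N (gaugeDir (flatCfg : Site d → Fin d → (Matrix n n ℂ)ˣ) (fun y => Λ (((L ^ (j + 1) : ℕ) : ℤ) • y))))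
  | 0, Λ, hΛ => by
      haveI : NeZero (L * N) := ⟨Nat.mul_ne_zero (NeZero.ne L) (NeZero.ne N)⟩
      show skewPR N ((fderiv ℝ (coord (ContinuousLinearMap.id ℝ (Matrix n n ℂ)) L N (flatCfg : Site d → Fin d → (Matrix n n ℂ)ˣ)) 0)
        (resDir (L * N) (gaugeDir (flatCfg : Site d → Fin d → (Matrix n n ℂ)ˣ) Λ))) = _
      rw [fderiv_coord_flatCfg_resDir_gaugeDir (L := L) (M := N) hΛ, zero_add, pow_one]
  | j + 1, Λ, hΛ => by
      haveI : NeZero (L * tower L N j) := ⟨Nat.mul_ne_zero (NeZero.ne L) (tower_ne_zero L N j)⟩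
      haveI : NeZero (L * (L * tower L N j)) := ⟨Nat.mul_ne_zero (NeZero.ne L) (Nat.mul_ne_zero (NeZero.ne L) (tower_ne_zero L N j))⟩
      rw [levelQ'_succ_flatCfg]
      have hΛ' : ∀ (x : Site d) (i : Fin d), Λ (x + ((L * (L * tower L N j) : ℕ) : ℤ) • e i) = Λ x := hΛ
      have h1 := fderiv_coord_flatCfg_resDir_gaugeDir (d := d) (n := n) (L := L) (M := L * tower L N j) hΛ'
      have hΛ'' : ∀ (x : Site d) (i : Fin d), (fun y => Λ ((L : ℤ) • y)) (x + ((L * tower L N j : ℕ) : ℤ) • e i) = (fun y => Λ ((L : ℤ) • y)) x := by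
        intro x i
        have h := hΛ'
        simp only [Nat.cast_mul] at h
        exact periodic_comp_smul (P := (L : ℤ) * (tower L N j : ℕ)) (by simpa only [Nat.cast_mul] using h) x i
      have h2 := levelQ'_flatCfg_resDir_gaugeDir j (fun y => Λ ((L : ℤ) • y)) hΛ''
      simp only [smul_smul, ← Nat.cast_mul, ← pow_succ'] at h2
      show levelQ' L N j (flatCfg : Site d → Fin d → (Matrix n n ℂ)ˣ)
          ((fderiv ℝ (coord (ContinuousLinearMap.id ℝ (Matrix n n ℂ)) L (L * tower L N j) (flatCfg : Site d → Fin d → (Matrix n n ℂ)ˣ)) 0)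
            (resDir (L * (L * tower L N j)) (gaugeDir (flatCfg : Site d → Fin d → (Matrix n n ℂ)ˣ) Λ))) = _
      rw [h1, h2, pow_succ]

omit [DecidableEq n] in
/-- `skewPR` is the identity on skew torus fields (as elements of `skewSub`). [folklore] -/
theorem skewPR_of_mem {N : ℕ} {Φ : TDir d n N} (hΦ : Φ ∈ skewSub d n N) : skewPR N Φ = ⟨Φ, hΦ⟩ := by
  apply Subtype.ext
  show skewPF N Φ = Φ
  exact skewPF_of_mem hΦ

/-- The flat curl of a flat pure gauge plus a constant field vanishes (`d∘d = 0`, and constants are closed). [folklore] -/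
theorem curlAt_flatCfg_gaugeDir_add_const (Λ : Site d → Matrix n n ℂ) (a : Fin d → Matrix n n ℂ) (z : Site d) (μ ν : Fin d) :
    curlAt (flatCfg : Site d → Fin d → (Matrix n n ℂ)ˣ)
      (fun x κ => gaugeDir (flatCfg : Site d → Fin d → (Matrix n n ℂ)ˣ) Λ x κ + a κ) z μ ν = 0 := by
  simp only [curlAt_flatCfg, gaugeDir_flatCfg, add_right_comm z (e ν) (e μ)]
  abel

/-! ## §3 The zero modes (`d = 4`): exact fields and constants -/

/-- **THE EFFECTIVE FORM VANISHES ON EXACT-PLUS-CONSTANT COARSE FIELDS, EVERY LEVEL** (`d = 4`, every `U(n)`, `L ≥ 2`): for `0 < ε ≤ ε₀`, `N ≥ 1`, every `j`, every `N`-periodic skew site field `λ`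
and every skew `c : Fin 4 → 𝔲(n)`: if `ṽ(x, μ) = (λ(x) − λ(x + e_μ)) + c_μ` then `D²(minAct 4 (sfClass 4 L N ε) L N (j+1) ∘ chart_1)(0)[v, v] = 0`. [folklore] -/
theorem effectiveForm_exact_add_const_eq_zero_flat_allLevels [Nonempty n] {L : ℕ} [NeZero L] (hL : 2 ≤ L) :
    ∃ ε₀ : ℝ, 0 < ε₀ ∧ ∀ ε : ℝ, 0 < ε → ε ≤ ε₀ → ∀ (N : ℕ) [NeZero N], 1 ≤ N → ∀ (j : ℕ) (lam : Site 4 → Matrix n n ℂ) (c : Fin 4 → Matrix n n ℂ),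
      (∀ (x : Site 4) (i : Fin 4), lam (x + (N : ℤ) • e i) = lam x) → (∀ x : Site 4, lam x ∈ skewAdjoint (Matrix n n ℂ)) →
      (∀ μ : Fin 4, c μ ∈ skewAdjoint (Matrix n n ℂ)) →
      ∀ v : ↥(skewSub 4 n N), (v : TDir 4 n N) = resDir N (fun x μ => gaugeDir (flatCfg : Site 4 → Fin 4 → (Matrix n n ℂ)ˣ) lam x μ + c μ) →
        fderiv ℝ (fderiv ℝ (fun y : ↥(skewSub 4 n N) => minAct 4 (sfClass 4 L N ε) L N (j + 1)
            (chart (ContinuousLinearMap.id ℝ (Matrix n n ℂ)) N (flatCfg : Site 4 → Fin 4 → (Matrix n n ℂ)ˣ) (y : TDir 4 n N)))) 0 v v = 0 := by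
  obtain ⟨ε₀, hε₀, H⟩ := effectiveForm_eq_zero_of_curlFree_lift (n := n) hL
  refine ⟨ε₀, hε₀, fun ε hε hεle N _ hN j lam c hlamP hlamS hcS v hv => ?_⟩
  have hL0 : (L : ℝ) ≠ 0 := by exact_mod_cast (NeZero.ne L)
  haveI : NeZero (L * tower L N j) := ⟨Nat.mul_ne_zero (NeZero.ne L) (tower_ne_zero L N j)⟩
  set M : ℕ := L * tower L N j with hM
  have hMeq : M = N * L ^ (j + 1) := by rw [hM, tower_window]
  have hMeq' : (M : ℤ) = ((L ^ (j + 1) : ℕ) : ℤ) * (N : ℤ) := by rw [hMeq]; push_cast; ring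
  have hLj1 : 1 ≤ L ^ (j + 1) := Nat.one_le_pow _ _ (Nat.pos_of_ne_zero (NeZero.ne L))
  -- the lifted potential and the lifted constant
  set Λ : Site 4 → Matrix n n ℂ := fun x => lam (cdiv (L ^ (j + 1)) x) with hΛ
  set a : Fin 4 → Matrix n n ℂ := fun μ => (((L : ℝ) ^ (j + 1))⁻¹ : ℝ) • c μ with ha
  have hΛP : ∀ (x : Site 4) (i : Fin 4), Λ (x + ((L * tower L N j : ℕ) : ℤ) • e i) = Λ x := by
    intro x i
    simp only [hΛ]
    rw [← hM, hMeq', cdiv_add_period hLj1, hlamP]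
  have hΛtop : ∀ y : Site 4, Λ (((L ^ (j + 1) : ℕ) : ℤ) • y) = lam y := by
    intro y
    simp only [hΛ]
    have h := cdiv_smul_add_boxVec (L ^ (j + 1)) y (fun _ => ⟨0, hLj1⟩)
    have h0 : boxVec (L ^ (j + 1)) (fun _ : Fin 4 => (⟨0, hLj1⟩ : Fin (L ^ (j + 1)))) = 0 := by
      funext i; simp [boxVec]
    rw [h0, add_zero] at h
    rw [h]
  -- the fine field
  set φ : Site 4 → Fin 4 → Matrix n n ℂ := fun x κ => gaugeDir (flatCfg : Site 4 → Fin 4 → (Matrix n n ℂ)ˣ) Λ x κ + a κ with hφ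
  have hφskew : resDir M φ ∈ skewSub 4 n M := by
    intro r κ
    simp only [resDir, hφ, gaugeDir_flatCfg, ha, hΛ]
    exact (skewAdjoint (Matrix n n ℂ)).add_mem ((skewAdjoint (Matrix n n ℂ)).sub_mem (hlamS _) (hlamS _)) (skewAdjoint.smul_mem _ (hcS κ))
  have hφP : IsPeriodicDir φ ((M : ℕ) : ℤ) := by
    intro x i κ
    simp only [hφ]
    rw [(isPeriodicDir_gaugeDir (isPeriodicCfg_flatCfg _) hΛP : IsPeriodicDir _ ((M : ℕ) : ℤ)) x i κ]
  -- its iterated average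
  have hlevel : levelQ' L N j (flatCfg : Site 4 → Fin 4 → (Matrix n n ℂ)ˣ) (resDir M φ) = v := by
    have hsplit : resDir M φ = resDir M (gaugeDir (flatCfg : Site 4 → Fin 4 → (Matrix n n ℂ)ˣ) Λ) + fun (_ : Fin 4 → Fin M) (κ : Fin 4) => a κ := by
      funext r κ; simp only [resDir, hφ, Pi.add_apply]
    rw [hsplit, map_add, levelQ'_flatCfg_resDir_gaugeDir j Λ hΛP, levelQ'_flatCfg_const j a, ← map_add]
    have hva : (resDir N (gaugeDir (flatCfg : Site 4 → Fin 4 → (Matrix n n ℂ)ˣ) (fun y => Λ (((L ^ (j + 1) : ℕ) : ℤ) • y)))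
        + fun (_ : Fin 4 → Fin N) (κ : Fin 4) => ((L : ℝ) ^ (j + 1)) • a κ) = (v : TDir 4 n N) := by
      rw [hv]
      funext r κ
      simp only [Pi.add_apply, resDir, gaugeDir_flatCfg, hΛtop, ha, smul_smul, mul_inv_cancel₀ (pow_ne_zero _ hL0), one_smul]
    rw [hva, skewPR_of_mem v.2]
  -- it is curl-free
  have hcurl : ∀ p ∈ perWin 4 (N * L ^ (j + 1)),
      curl (flatCfg : Site 4 → Fin 4 → (Matrix n n ℂ)ˣ) (chartDir (ContinuousLinearMap.id ℝ (Matrix n n ℂ)) M (resDir M φ)) p = 0 := by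
    intro p _
    rw [chartDir_id_resDir M hφP]
    exact curlAt_flatCfg_gaugeDir_add_const Λ a p.1 p.2.1.1 p.2.1.2
  exact (H ε hε hεle N hN j v).2 ⟨resDir M φ, hφskew⟩ hlevel hcurl

/-- **GAUGE INVARIANCE OF THE EFFECTIVE FORM AT SECOND ORDER**: `D²(minAct_{j+1} ∘ chart_1)(0)[dλ, dλ] = 0` for every `N`-periodic skew site field `λ` (`ṽ(x, μ) = λ(x) − λ(x + e_μ)`),
every level `j`. [folklore] -/
theorem effectiveForm_exact_eq_zero_flat_allLevels [Nonempty n] {L : ℕ} [NeZero L] (hL : 2 ≤ L) :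
    ∃ ε₀ : ℝ, 0 < ε₀ ∧ ∀ ε : ℝ, 0 < ε → ε ≤ ε₀ → ∀ (N : ℕ) [NeZero N], 1 ≤ N → ∀ (j : ℕ) (lam : Site 4 → Matrix n n ℂ),
      (∀ (x : Site 4) (i : Fin 4), lam (x + (N : ℤ) • e i) = lam x) → (∀ x : Site 4, lam x ∈ skewAdjoint (Matrix n n ℂ)) →
      ∀ v : ↥(skewSub 4 n N), (v : TDir 4 n N) = resDir N (gaugeDir (flatCfg : Site 4 → Fin 4 → (Matrix n n ℂ)ˣ) lam) →
        fderiv ℝ (fderiv ℝ (fun y : ↥(skewSub 4 n N) => minAct 4 (sfClass 4 L N ε) L N (j + 1)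
            (chart (ContinuousLinearMap.id ℝ (Matrix n n ℂ)) N (flatCfg : Site 4 → Fin 4 → (Matrix n n ℂ)ˣ) (y : TDir 4 n N)))) 0 v v = 0 := by
  obtain ⟨ε₀, hε₀, H⟩ := effectiveForm_exact_add_const_eq_zero_flat_allLevels (n := n) hL
  refine ⟨ε₀, hε₀, fun ε hε hεle N _ hN j lam hlamP hlamS v hv => ?_⟩
  refine H ε hε hεle N hN j lam (fun _ => 0) hlamP hlamS (fun _ => (skewAdjoint (Matrix n n ℂ)).zero_mem) v ?_
  rw [hv]
  funext r κ
  simp only [resDir, add_zero]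

/-- **THE ZERO MODE**: `D²(minAct_{j+1} ∘ chart_1)(0)[c, c] = 0` for every constant skew coarse field `c`, every level `j`. [folklore] -/
theorem effectiveForm_const_eq_zero_flat_allLevels [Nonempty n] {L : ℕ} [NeZero L] (hL : 2 ≤ L) :
    ∃ ε₀ : ℝ, 0 < ε₀ ∧ ∀ ε : ℝ, 0 < ε → ε ≤ ε₀ → ∀ (N : ℕ) [NeZero N], 1 ≤ N → ∀ (j : ℕ) (c : Fin 4 → Matrix n n ℂ),
      (∀ μ : Fin 4, c μ ∈ skewAdjoint (Matrix n n ℂ)) →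
      ∀ v : ↥(skewSub 4 n N), (∀ (r : Fin 4 → Fin N) (κ : Fin 4), (v : TDir 4 n N) r κ = c κ) →
        fderiv ℝ (fderiv ℝ (fun y : ↥(skewSub 4 n N) => minAct 4 (sfClass 4 L N ε) L N (j + 1)
            (chart (ContinuousLinearMap.id ℝ (Matrix n n ℂ)) N (flatCfg : Site 4 → Fin 4 → (Matrix n n ℂ)ˣ) (y : TDir 4 n N)))) 0 v v = 0 := by
  obtain ⟨ε₀, hε₀, H⟩ := effectiveForm_exact_add_const_eq_zero_flat_allLevels (n := n) hL
  refine ⟨ε₀, hε₀, fun ε hε hεle N _ hN j c hcS v hv => ?_⟩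
  refine H ε hε hεle N hN j (fun _ => 0) c (fun _ _ => rfl) (fun _ => (skewAdjoint (Matrix n n ℂ)).zero_mem) hcS v ?_
  funext r κ
  rw [hv r κ]
  simp only [resDir, gaugeDir_flatCfg, sub_self, zero_add]

end

end Summit.QuantumFields.BalabanUV.T4Continuum.NE7EffectiveFormFlatZeroModes
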